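import Summits.SmoothPoincare4.SmoothPoincare4.Theorems.CongruenceShadowsShadowApproximationStubLayerStepZeroPair
import Summits.SmoothPoincare4.SmoothPoincare4.Theorems.CongruenceShadowsShadowApproximationStubLayerStepZeroRealiser
import Summits.SmoothPoincare4.SmoothPoincare4.Theorems.NilpotentShadowsStandard.Negative.LoadBearing
import Summits.SmoothPoincare4.SmoothPoincare4.Theorems.CongruenceShadowsNilpotentShadowsStandardStubLevelOneGlue
import Summits.SmoothPoincare4.SmoothPoincare4.Theorems.CongruenceShadowsNilpotentShadowsStandardStubMagnusWittRead
import HarnessLib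

/-!
# Stub `stub_layerStepZero` of line `nilpotent-genus-class` for crux `CongruenceShadows.ShadowApproximation`
(item stmt-SmoothPoincare4-14595, thesis `Summit.SmoothPoincare4.SmoothPoincare4.Theses.CongruenceShadows.ShadowApproximation`)

Proves the registered stub **`stub_layerStepZero`** verbatim — the LAYER STEP at `(m, c) = (0, 0)`
(abelian → 2-step nilpotent at genus `3`) — and the registered sub-goal `helper_layerStepZeroReading`.
Setting: `S = S₃`, `Nᵢ = s4Kernels i` (`N₀ = ⟪a₀,a₁,b₂⟫`, `N₁ = ⟪a₀,b₁,a₂⟫`, `N₂ = ⟪b₀,a₁,a₂⟫`),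
`γₖ₊₁ = (⊤).lowerCentralSeries k`; (AUTSYMP) every automorphism of every `S_g` acts on `H₁` by a
`±`-isometry; (REAL) every `±`-isometry of `H₁(S₃)` stabilising the coordinate Lagrangians `Λ₀, Λ₁` is
induced by an element of the Goeritz group `A ∩ B = Stab N₀ ∩ Stab N₁`.  CLAIM: for a kernel triple `K`
with `K₀ = N₀`, Waldhausen pairs and `K₂ γ₂ = N₂ γ₂`, some `y ∈ A ∩ B` has `y(N₂ γ₃) = K₂ γ₃`.

1. PAIR NORMALISATION (landed `exists_ia_of_pair`): the pair `(0, 2)` gives `α ∈ A`, `α(N₂) = K₂`; its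
   `±`-isometry stabilises `Λ₀ = [N₀]`, `Λ₂ = [N₂] = [K₂]`, so (REAL moved to the pair `(0,2)` by the slot
   symmetry `(N₀,N₁) ↦ (N₀,N₂)`) it is induced by some `x ∈ A ∩ C`, and `α' = α x⁻¹` is IA with `α'(N₂) = K₂`.
2. GOERITZ–JOHNSON REALISER (landed `exists_goeritzJohnson`): `y₁ = g β g⁻¹ ∈ A ∩ B` (`β` Johnson's
   bounding-pair map on handles `0,1`, `g ∈ A ∩ B` realising the slide `b₀ ↦ b₀+b₂`, `a₂ ↦ a₂-a₀`) is IA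
   with `y₁(b₀)b₀⁻¹ ≡ ([b₁,b₀][b₁,b₂])⁻¹ (mod γ₃)`.
3. READING (this file).  With the cut pattern `ct` of `N₂` (cut letters `x_h = b₀, a₁, a₂`) and its
   erasing projection `π : S ↠ F = FreeGroup (Fin 3)` (`ker π = N₂`, landed `helper_glueErasePi`), for an
   IA-automorphism `ψ` the kernel `ψ(N₂)` is HONEST (`S ⧸ ψ(N₂) ≅ F` along `π ∘ ψ⁻¹`) with abelian shadow
   `N₂γ₂`, so the landed READING lemma (`reading` + `stub_magnusWittRead`) reads the corrections
   `ψ(x_h)x_h⁻¹` through `π` as pair products `PP(s_h • D h)`, `PP(e) = ∏_{v<w} [y_v,y_w]^{e v w}`, of an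
   ALTERNATING form `D` on `Fin 3` — ONE integer `d(ψ) = D 0 1 2` (`reading_ia`, `alt3_table`; this is
   Johnson's `τ(ψ) ∈ Λ³H` modulo the cut ideal of `N₂`: `Der₁/𝔠₁ ≅ ℤ·a₀∧b₁∧b₂`, and the degree-1 Lie gate
   identity `(𝔞+𝔠)∩(𝔟+𝔠) = (𝔞∩𝔟)+𝔠` is vacuous in this degree).  Then `d(ψⁿ) = n d(ψ)` (`reading_zpow`,
   Johnson values of powers), `d(y₁) = 1` (`apex_eq_one`, by `INJ2`), and equal `d` gives equal level-two
   shadows `ψ(N₂)γ₃` (`map_le_of_forms`: torsor calculus `level_mem_iff` over the honest kernels, no hidden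
   depth, target transport).  Hence `y = y₁ ^ d(α') ∈ A ∩ B` has `y(N₂)γ₃ = α'(N₂)γ₃ = K₂γ₃`.
The hypotheses `IsGroupTrisection`, `K 1 = N₁`, the pairs other than `(0,2)` and the standard finite SHADOWS
are not used: at genus `3` the 2-step level is automatic from the abelian one.  No definitions.
-/

-- the prescribed namespace `Summit.<P>.<Sub>.…` duplicates `SmoothPoincare4` (P = Sub)
set_option linter.dupNamespace false

noncomputable section

open Subgroup Literature.Topology.FourManifolds Literature.Algebra.Lie Multiplicative
open Summit.SmoothPoincare4.SmoothPoincare4.Theorems.NilpotentShadowsStandard.SaturatedTorsorDescent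
open scoped commutatorElement

namespace Summit.SmoothPoincare4.SmoothPoincare4.Theorems.ShadowApproximation.NilpotentGenusClass

/-! ## Generalities -/

/-- A stabiliser of `P` has all its integer powers (in `MulAut`) stabilising `P`. [folklore] -/
theorem map_zpow_eq_of_map_eq {G : Type*} [Group G] (ψ : G ≃* G) {P : Subgroup G}
    (h : P.map ψ.toMonoidHom = P) (n : ℤ) : P.map ((ψ : MulAut G) ^ n : MulAut G).toMonoidHom = P := by
  have htr : ∀ e₁ e₂ : G ≃* G, P.map (e₁.trans e₂).toMonoidHom = (P.map e₁.toMonoidHom).map e₂.toMonoidHom :=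
    fun e₁ e₂ => by rw [Subgroup.map_map]; rfl
  have hs : P.map ψ.symm.toMonoidHom = P := by
    ext x
    constructor
    · rintro ⟨y, hy, rfl⟩
      rw [← h] at hy
      obtain ⟨z, hz, rfl⟩ := hy
      simpa using hz
    · intro hx
      refine ⟨ψ x, ?_, by simp⟩
      rw [← h]
      exact ⟨x, hx, rfl⟩
  induction n using Int.induction_on with
  | zero => rw [zpow_zero]; exact Subgroup.map_id P
  | succ k ih => rw [zpow_add_one, MulAut.mul_def, htr, h, ih]
  | pred k ih => rw [zpow_sub_one, MulAut.mul_def, MulAut.inv_def, htr, hs, ih]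

/-- Pair products of CENTRAL elements: `PP(e) ^ n = PP(n • e)`. [folklore] -/
theorem pp_zpow_of_central {G : Type*} [Group G] {n : ℕ} (c : Fin n → Fin n → G) (hc : ∀ v w, c v w ∈ center G)
    (e : Fin n → Fin n → ℤ) (k : ℤ) :
    ((List.finRange n).map (fun v => ((List.finRange n).map (fun w =>
      if v < w then c v w ^ (e v w) else 1)).prod)).prod ^ k =
    ((List.finRange n).map (fun v => ((List.finRange n).map (fun w =>
      if v < w then c v w ^ (k * e v w) else 1)).prod)).prod := by
  have h0 : ((List.finRange n).map (fun v => ((List.finRange n).map (fun w =>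
      if v < w then c v w ^ ((0 : ℤ) * e v w) else 1)).prod)).prod = 1 := by
    simp
  induction k using Int.induction_on with
  | zero => rw [zpow_zero, h0]
  | succ k ih =>
    rw [zpow_add_one, ih, ← pp_add c hc]
    exact pp_congr _ _ _ _ fun v w _ => by rw [add_mul, one_mul]
  | pred k ih =>
    have e1 : ((List.finRange n).map (fun v => ((List.finRange n).map (fun w =>
        if v < w then c v w ^ ((-1 : ℤ) * e v w) else 1)).prod)).prod *
        ((List.finRange n).map (fun v => ((List.finRange n).map (fun w =>
        if v < w then c v w ^ (e v w) else 1)).prod)).prod = 1 := by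
      rw [← pp_add c hc]
      exact (pp_congr _ _ _ _ fun v w _ => by rw [neg_one_mul, neg_add_cancel, zero_mul]).trans h0
    rw [zpow_sub_one, ih, ← eq_inv_of_mul_eq_one_left e1, ← pp_add c hc]
    exact pp_congr _ _ _ _ fun v w _ => by rw [neg_one_mul, ← sub_eq_add_neg, sub_mul, one_mul]

/-- **Alternating forms on three letters are multiples of the volume form**: the nine entries
`D j v w`, `v < w`, of an alternating `D` are `0, 0, d; 0, -d, 0; d, 0, 0` with `d = D 0 1 2`.
[folklore] -/
theorem alt3_table (D : Fin 3 → Fin 3 → Fin 3 → ℤ) (h1 : ∀ a b c, D b a c = -D a b c)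
    (h2 : ∀ a b c, D a c b = -D a b c) :
    D 0 0 1 = 0 ∧ D 0 0 2 = 0 ∧ D 1 0 1 = 0 ∧ D 1 1 2 = 0 ∧ D 2 0 2 = 0 ∧ D 2 1 2 = 0 ∧
      D 1 0 2 = -D 0 1 2 ∧ D 2 0 1 = D 0 1 2 := by
  refine ⟨by linarith [h1 0 0 1], by linarith [h1 0 0 2], by linarith [h2 1 0 1, h1 1 1 0],
    by linarith [h1 1 1 2], by linarith [h2 2 0 2, h1 2 2 0], by linarith [h2 2 1 2, h1 2 2 1],
    h1 0 1 2, by linarith [h1 0 2 1, h2 0 1 2]⟩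

/-- Two alternating forms on three letters with the same apex `D 0 1 2` agree at all `(j; v < w)`.
[folklore] -/
theorem alt3_eq_of_apex (D D' : Fin 3 → Fin 3 → Fin 3 → ℤ) (h1 : ∀ a b c, D b a c = -D a b c)
    (h2 : ∀ a b c, D a c b = -D a b c) (h1' : ∀ a b c, D' b a c = -D' a b c)
    (h2' : ∀ a b c, D' a c b = -D' a b c) (h : D 0 1 2 = D' 0 1 2) :
    ∀ j v w : Fin 3, v < w → D j v w = D' j v w := by
  obtain ⟨e1, e2, e3, e4, e5, e6, e7, e8⟩ := alt3_table D h1 h2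
  obtain ⟨f1, f2, f3, f4, f5, f6, f7, f8⟩ := alt3_table D' h1' h2'
  intro j v w hvw
  fin_cases j <;> fin_cases v <;> fin_cases w <;>
    first
    | exact absurd hvw (by decide)
    | (simp only [Fin.zero_eta, Fin.mk_one, Fin.reduceFinMk, Fin.isValue] at *; linarith)

/-! ## The cut pattern of slot `2` and its erasing projection -/

section Cut

variable {ct : Fin 3 → Bool} {π : SurfaceGroup 3 →* FreeGroup (Fin 3)}

/-- The cut letters of slot `2` are `b₀, a₁, a₂`: `ct = (true, false, false)`. [folklore] -/
theorem ct_values (hct : ∀ (h : Fin 3) (c : Bool), ((h, c) ∈ s4CutSystem 0 2 ↔ c = ct h)) :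
    ct 0 = true ∧ ct 1 = false ∧ ct 2 = false := by
  refine ⟨((hct 0 true).1 ?_).symm, ((hct 1 false).1 ?_).symm, ((hct 2 false).1 ?_).symm⟩ <;>
  · rw [s4CutSystem_zero, Finset.mem_coe]; decide

/-- The cut letters lie in `N₂ = ker π`. [folklore] -/
theorem of_cut_mem_ker (hπof : ∀ (h : Fin 3) (c : Bool), π (PresentedGroup.of (h, c)) = if c = ct h then 1 else FreeGroup.of h)
    (j : Fin 3) : (PresentedGroup.of (j, ct j) : SurfaceGroup 3) ∈ π.ker := by
  rw [MonoidHom.mem_ker, hπof, if_pos rfl]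

/-- The kernel `ψ(N₂)` of an automorphism `ψ` is honest: it is the kernel of the surjection
`π ∘ ψ⁻¹ : S ↠ F`. [folklore] -/
theorem ker_comp_symm (hπker : π.ker = s4Kernels 2) (ψ : SurfaceGroup 3 ≃* SurfaceGroup 3) :
    (π.comp ψ.symm.toMonoidHom).ker = (s4Kernels 2).map ψ.toMonoidHom := by
  rw [← MonoidHom.comap_ker, hπker, ← Subgroup.map_equiv_eq_comap_symm']

/-- An IA-automorphism moves `N₂` only within its abelian shadow: `ψ(N₂) ≤ N₂ γ₂`. [folklore] -/
theorem map_le_sup_of_ia (ψ : SurfaceGroup 3 ≃* SurfaceGroup 3) (hψ : (∀ s : SurfaceGroup 3, ψ s * s⁻¹ ∈ (⊤ : Subgroup (SurfaceGroup 3)).lowerCentralSeries 1)) (P : Subgroup (SurfaceGroup 3)) :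
    P.map ψ.toMonoidHom ≤ P ⊔ (⊤ : Subgroup (SurfaceGroup 3)).lowerCentralSeries 1 := by
  rintro _ ⟨s, hs, rfl⟩
  have e : ψ.toMonoidHom s = (ψ s * s⁻¹) * s := by simp
  rw [e]
  exact mul_mem (mem_sup_right (hψ s)) (mem_sup_left hs)

/-- For IA `ψ`: `ψ(N₂) γ₂ = N₂ γ₂`. [folklore] -/
theorem map_sup_lcs_one_of_ia (ψ : SurfaceGroup 3 ≃* SurfaceGroup 3) (hψ : (∀ s : SurfaceGroup 3, ψ s * s⁻¹ ∈ (⊤ : Subgroup (SurfaceGroup 3)).lowerCentralSeries 1)) (P : Subgroup (SurfaceGroup 3)) :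
    P.map ψ.toMonoidHom ⊔ (⊤ : Subgroup (SurfaceGroup 3)).lowerCentralSeries 1 = P ⊔ (⊤ : Subgroup (SurfaceGroup 3)).lowerCentralSeries 1 := by
  have h := ia_map_sup_lcs_one hψ P
  rw [Subgroup.map_sup, Summit.SmoothPoincare4.SmoothPoincare4.Theorems.NilpotentShadowsStandard.Negative.map_lcs_top_equiv] at h
  exact h

/-- **Reading an IA-automorphism.** For IA `ψ` the corrections `ψ(x_h) x_h⁻¹` at the cut letters of
`N₂` read through `π` as pair products of an alternating form `D` (the landed `reading` applied to the
honest kernel `ψ(N₂)`, with READ from `stub_magnusWittRead`). [folklore] -/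
theorem reading_ia (hπs : Function.Surjective π) (hπker : π.ker = s4Kernels 2)
    (hπof : ∀ (h : Fin 3) (c : Bool), π (PresentedGroup.of (h, c)) = if c = ct h then 1 else FreeGroup.of h)
    (ψ : SurfaceGroup 3 ≃* SurfaceGroup 3) (hψ : (∀ s : SurfaceGroup 3, ψ s * s⁻¹ ∈ (⊤ : Subgroup (SurfaceGroup 3)).lowerCentralSeries 1)) :
    ∃ D : Fin 3 → Fin 3 → Fin 3 → ℤ, (∀ a b c, D b a c = -D a b c) ∧ (∀ a b c, D a c b = -D a b c) ∧
      ∀ j : Fin 3, π (ψ (PresentedGroup.of (j, ct j) : SurfaceGroup 3) * (PresentedGroup.of (j, ct j) : SurfaceGroup 3)⁻¹) * (((List.finRange 3).map (fun v => ((List.finRange 3).map (fun w => if v < w then ⁅(FreeGroup.of v : FreeGroup (Fin 3)), FreeGroup.of w⁆ ^ ((if ct j then (-1 : ℤ) else 1) * D j v w) else (1 : FreeGroup (Fin 3)))).prod)).prod)⁻¹ ∈ (⊤ : Subgroup (FreeGroup (Fin 3))).lowerCentralSeries 2 := by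
  refine reading stub_magnusWittRead.2 ct π hπof ((s4Kernels 2).map ψ.toMonoidHom)
    (π.comp ψ.symm.toMonoidHom) (hπs.comp ψ.symm.surjective) (ker_comp_symm hπker ψ) ?_
    (fun h => ψ (PresentedGroup.of (h, ct h)) * (PresentedGroup.of (h, ct h) : SurfaceGroup 3)⁻¹) (fun h => hψ _)
    (fun h => ?_)
  · rw [hπker]; exact map_le_sup_of_ia ψ hψ _
  · rw [inv_mul_cancel_right]
    refine ⟨PresentedGroup.of (h, ct h), ?_, rfl⟩
    rw [SetLike.mem_coe, ← hπker]
    exact of_cut_mem_ker hπof h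

/-- **Powers.** If `ψ` reads as `D` then `ψ ^ n` (power in `MulAut S`) is IA and reads as `n • D`.
[folklore] -/
theorem reading_zpow (π : SurfaceGroup 3 →* FreeGroup (Fin 3)) (ψ : SurfaceGroup 3 ≃* SurfaceGroup 3) (hψ : (∀ s : SurfaceGroup 3, ψ s * s⁻¹ ∈ (⊤ : Subgroup (SurfaceGroup 3)).lowerCentralSeries 1))
    (D : Fin 3 → Fin 3 → Fin 3 → ℤ) (hD : ∀ j : Fin 3, π (ψ (PresentedGroup.of (j, ct j) : SurfaceGroup 3) * (PresentedGroup.of (j, ct j) : SurfaceGroup 3)⁻¹) * (((List.finRange 3).map (fun v => ((List.finRange 3).map (fun w => if v < w then ⁅(FreeGroup.of v : FreeGroup (Fin 3)), FreeGroup.of w⁆ ^ ((if ct j then (-1 : ℤ) else 1) * D j v w) else (1 : FreeGroup (Fin 3)))).prod)).prod)⁻¹ ∈ (⊤ : Subgroup (FreeGroup (Fin 3))).lowerCentralSeries 2) (n : ℤ) :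
    (∀ s : SurfaceGroup 3, ((ψ : MulAut (SurfaceGroup 3)) ^ n : MulAut (SurfaceGroup 3)) s * s⁻¹ ∈ (⊤ : Subgroup (SurfaceGroup 3)).lowerCentralSeries 1) ∧
    ∀ j : Fin 3, π (((ψ : MulAut (SurfaceGroup 3)) ^ n : MulAut (SurfaceGroup 3)) (PresentedGroup.of (j, ct j) : SurfaceGroup 3) * (PresentedGroup.of (j, ct j) : SurfaceGroup 3)⁻¹) * (((List.finRange 3).map (fun v => ((List.finRange 3).map (fun w => if v < w then ⁅(FreeGroup.of v : FreeGroup (Fin 3)), FreeGroup.of w⁆ ^ ((if ct j then (-1 : ℤ) else 1) * (n * D j v w)) else (1 : FreeGroup (Fin 3)))).prod)).prod)⁻¹ ∈ (⊤ : Subgroup (FreeGroup (Fin 3))).lowerCentralSeries 2 := by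
  obtain ⟨h1, h2⟩ := ia_zpow hψ n
  refine ⟨h1, fun j => ?_⟩
  -- push the Johnson value through `π̄ : S ⧸ γ₃ S → F ⧸ γ₃ F`
  have hle : (⊤ : Subgroup (SurfaceGroup 3)).lowerCentralSeries 2 ≤ ((⊤ : Subgroup (FreeGroup (Fin 3))).lowerCentralSeries 2).comap π := fun s hs => map_lcs_mem π hs
  have hbar : ∀ s : SurfaceGroup 3, (π s : FreeGroup (Fin 3) ⧸ (⊤ : Subgroup (FreeGroup (Fin 3))).lowerCentralSeries 2) =
      QuotientGroup.map _ ((⊤ : Subgroup (FreeGroup (Fin 3))).lowerCentralSeries 2) π hle (s : SurfaceGroup 3 ⧸ (⊤ : Subgroup (SurfaceGroup 3)).lowerCentralSeries 2) := fun s => rfl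
  have hcen : ∀ v w : Fin 3, (QuotientGroup.mk' ((⊤ : Subgroup (FreeGroup (Fin 3))).lowerCentralSeries 2)) ⁅(FreeGroup.of v : FreeGroup (Fin 3)), FreeGroup.of w⁆ ∈
      center (FreeGroup (Fin 3) ⧸ (⊤ : Subgroup (FreeGroup (Fin 3))).lowerCentralSeries 2) := fun v w => by
    rw [map_commutatorElement]; exact quot_commutator_mem_center _ _
  have hj := hD j
  rw [mul_inv_mem_iff_quot] at hj ⊢
  rw [hbar, h2, map_zpow, ← hbar, hj]
  simp only [← QuotientGroup.mk'_apply]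
  rw [pp_map, pp_zpow_of_central _ hcen, pp_map]
  exact pp_congr _ _ _ _ fun v w _ => by rw [mul_left_comm]

/-- **The apex of a Goeritz–Johnson realiser.** If `ψ` reads as `D` and `ψ(b₀) b₀⁻¹ ≡ ([b₁,b₀][b₁,b₂])⁻¹
(mod γ₃ S)`, then `D 0 1 2 = 1` (`π` kills `b₀`, so `π(ψ(b₀)b₀⁻¹) ≡ [y₁, y₂]⁻¹`, while the reading gives
`[y₁,y₂]^(-D 0 1 2)`; compare by `INJ2`). [folklore] -/
theorem apex_eq_one (hct : ∀ (h : Fin 3) (c : Bool), ((h, c) ∈ s4CutSystem 0 2 ↔ c = ct h))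
    (hπof : ∀ (h : Fin 3) (c : Bool), π (PresentedGroup.of (h, c)) = if c = ct h then 1 else FreeGroup.of h)
    (ψ : SurfaceGroup 3 ≃* SurfaceGroup 3) (D : Fin 3 → Fin 3 → Fin 3 → ℤ)
    (hD : ∀ j : Fin 3, π (ψ (PresentedGroup.of (j, ct j) : SurfaceGroup 3) * (PresentedGroup.of (j, ct j) : SurfaceGroup 3)⁻¹) * (((List.finRange 3).map (fun v => ((List.finRange 3).map (fun w => if v < w then ⁅(FreeGroup.of v : FreeGroup (Fin 3)), FreeGroup.of w⁆ ^ ((if ct j then (-1 : ℤ) else 1) * D j v w) else (1 : FreeGroup (Fin 3)))).prod)).prod)⁻¹ ∈ (⊤ : Subgroup (FreeGroup (Fin 3))).lowerCentralSeries 2)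
    (hJ : ψ (SurfaceGroup.b 0 : SurfaceGroup 3) * (SurfaceGroup.b 0 : SurfaceGroup 3)⁻¹ * (⁅(SurfaceGroup.b 1 : SurfaceGroup 3), (SurfaceGroup.b 0 : SurfaceGroup 3)⁆ * ⁅(SurfaceGroup.b 1 : SurfaceGroup 3), (SurfaceGroup.b 2 : SurfaceGroup 3)⁆) ∈ (⊤ : Subgroup (SurfaceGroup 3)).lowerCentralSeries 2) : D 0 1 2 = 1 := by
  obtain ⟨c0, c1, c2⟩ := ct_values hct
  have hπb0 : π (SurfaceGroup.b 0 : SurfaceGroup 3) = 1 := by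
    rw [SurfaceGroup.b, hπof, c0, if_pos rfl]
  have hπb1 : π (SurfaceGroup.b 1 : SurfaceGroup 3) = FreeGroup.of 1 := by
    rw [SurfaceGroup.b, hπof, c1, if_neg (by decide)]
  have hπb2 : π (SurfaceGroup.b 2 : SurfaceGroup 3) = FreeGroup.of 2 := by
    rw [SurfaceGroup.b, hπof, c2, if_neg (by decide)]
  have hx0 : (PresentedGroup.of (0, ct 0) : SurfaceGroup 3) = (SurfaceGroup.b 0 : SurfaceGroup 3) := by rw [c0]; rfl
  -- the two congruences for `π (ψ b₀ b₀⁻¹)` in `F ⧸ γ₃ F`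
  have hA := hD 0
  rw [hx0, mul_inv_mem_iff_quot] at hA
  have hB : π (ψ (SurfaceGroup.b 0 : SurfaceGroup 3) * (SurfaceGroup.b 0 : SurfaceGroup 3)⁻¹) * ⁅(FreeGroup.of 1 : FreeGroup (Fin 3)), FreeGroup.of 2⁆ ∈ (⊤ : Subgroup (FreeGroup (Fin 3))).lowerCentralSeries 2 := by
    have h := map_lcs_mem π hJ
    rwa [map_mul π (ψ (SurfaceGroup.b 0 : SurfaceGroup 3) * (SurfaceGroup.b 0 : SurfaceGroup 3)⁻¹), map_mul π ⁅(SurfaceGroup.b 1 : SurfaceGroup 3), (SurfaceGroup.b 0 : SurfaceGroup 3)⁆, map_commutatorElement,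
      map_commutatorElement, hπb0, hπb1, hπb2, commutatorElement_one_right, one_mul] at h
  rw [← QuotientGroup.eq_one_iff, QuotientGroup.mk_mul, hA, ← QuotientGroup.mk_mul, QuotientGroup.eq_one_iff] at hB
  -- `[y₁, y₂] = PP(δ₁₂)`; combine the pair products and read off the `(1,2)` exponent by `INJ2`
  have hcen : ∀ v w : Fin 3, (QuotientGroup.mk' ((⊤ : Subgroup (FreeGroup (Fin 3))).lowerCentralSeries 2)) ⁅(FreeGroup.of v : FreeGroup (Fin 3)), FreeGroup.of w⁆ ∈
      center (FreeGroup (Fin 3) ⧸ (⊤ : Subgroup (FreeGroup (Fin 3))).lowerCentralSeries 2) := fun v w => by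
    rw [map_commutatorElement]; exact quot_commutator_mem_center _ _
  have hsingle : ⁅(FreeGroup.of 1 : FreeGroup (Fin 3)), FreeGroup.of 2⁆ =
      ((List.finRange 3).map (fun v => ((List.finRange 3).map (fun w => if v < w then ⁅(FreeGroup.of v : FreeGroup (Fin 3)), FreeGroup.of w⁆ ^ (if v = 1 ∧ w = 2 then (1 : ℤ) else 0) else (1 : FreeGroup (Fin 3)))).prod)).prod := by
    symm
    rw [List.prod_map_eq_pow_single (1 : Fin 3) _ fun v hv _ =>
      List.prod_eq_one (List.forall_mem_map.2 fun w _ => by simp [hv])]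
    rw [List.count_finRange, pow_one, List.prod_map_eq_pow_single (2 : Fin 3) _ fun w hw _ => by simp [hw]]
    simp
  rw [hsingle, ← QuotientGroup.ker_mk' ((⊤ : Subgroup (FreeGroup (Fin 3))).lowerCentralSeries 2), MonoidHom.mem_ker, map_mul, pp_map, pp_map,
    ← pp_add _ hcen, ← pp_map, ← MonoidHom.mem_ker, QuotientGroup.ker_mk'] at hB
  have h12 := stub_magnusWittRead.1 3 _ hB 1 2 (by decide)
  simp only [c0, ite_true, and_self] at h12
  linarith

/-- **Equal readings give equal level-two shadows (one inclusion).** [folklore] -/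
theorem map_le_of_forms (hct : ∀ (h : Fin 3) (c : Bool), ((h, c) ∈ s4CutSystem 0 2 ↔ c = ct h))
    (hπs : Function.Surjective π) (hπker : π.ker = s4Kernels 2)
    (hπof : ∀ (h : Fin 3) (c : Bool), π (PresentedGroup.of (h, c)) = if c = ct h then 1 else FreeGroup.of h)
    (ψ φ : SurfaceGroup 3 ≃* SurfaceGroup 3) (hψ : (∀ s : SurfaceGroup 3, ψ s * s⁻¹ ∈ (⊤ : Subgroup (SurfaceGroup 3)).lowerCentralSeries 1)) (hφ : (∀ s : SurfaceGroup 3, φ s * s⁻¹ ∈ (⊤ : Subgroup (SurfaceGroup 3)).lowerCentralSeries 1))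
    (D D' : Fin 3 → Fin 3 → Fin 3 → ℤ) (hD : ∀ j : Fin 3, π (ψ (PresentedGroup.of (j, ct j) : SurfaceGroup 3) * (PresentedGroup.of (j, ct j) : SurfaceGroup 3)⁻¹) * (((List.finRange 3).map (fun v => ((List.finRange 3).map (fun w => if v < w then ⁅(FreeGroup.of v : FreeGroup (Fin 3)), FreeGroup.of w⁆ ^ ((if ct j then (-1 : ℤ) else 1) * D j v w) else (1 : FreeGroup (Fin 3)))).prod)).prod)⁻¹ ∈ (⊤ : Subgroup (FreeGroup (Fin 3))).lowerCentralSeries 2) (hD' : ∀ j : Fin 3, π (φ (PresentedGroup.of (j, ct j) : SurfaceGroup 3) * (PresentedGroup.of (j, ct j) : SurfaceGroup 3)⁻¹) * (((List.finRange 3).map (fun v => ((List.finRange 3).map (fun w => if v < w then ⁅(FreeGroup.of v : FreeGroup (Fin 3)), FreeGroup.of w⁆ ^ ((if ct j then (-1 : ℤ) else 1) * D' j v w) else (1 : FreeGroup (Fin 3)))).prod)).prod)⁻¹ ∈ (⊤ : Subgroup (FreeGroup (Fin 3))).lowerCentralSeries 2)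
    (heq : ∀ j v w : Fin 3, v < w → D j v w = D' j v w) :
    (s4Kernels 2).map ψ.toMonoidHom ≤ (s4Kernels 2).map φ.toMonoidHom ⊔ (⊤ : Subgroup (SurfaceGroup 3)).lowerCentralSeries 2 := by
  haveI hQn : ((s4Kernels 2).map φ.toMonoidHom).Normal :=
    (s4Kernels_isGroupTrisection_holds.normal 2).map _ φ.surjective
  haveI hPn : (s4Kernels 2).Normal := s4Kernels_isGroupTrisection_holds.normal 2
  have hQfree : IsFreeOfRank (SurfaceGroup 3 ⧸ (s4Kernels 2).map φ.toMonoidHom) 3 :=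
    (isFreeOfRank_quotient_ker (π.comp φ.symm.toMonoidHom) (hπs.comp φ.symm.surjective)).of_mulEquiv
      (QuotientGroup.quotientMulEquivOfEq (ker_comp_symm hπker φ))
  have hQnhd := stub_noHiddenDepth 3 3 ((s4Kernels 2).map φ.toMonoidHom) hQfree
  have hπnhd : π.ker ⊓ (⊤ : Subgroup (SurfaceGroup 3)).lowerCentralSeries 1 ≤ ⁅π.ker, (⊤ : Subgroup (SurfaceGroup 3))⁆ :=
    stub_noHiddenDepth 3 3 π.ker (isFreeOfRank_quotient_ker π hπs)
  have hQP : (s4Kernels 2).map φ.toMonoidHom ⊔ (⊤ : Subgroup (SurfaceGroup 3)).lowerCentralSeries 1 = s4Kernels 2 ⊔ (⊤ : Subgroup (SurfaceGroup 3)).lowerCentralSeries 1 := map_sup_lcs_one_of_ia φ hφ _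
  have hN2 : (s4Kernels 2 : Subgroup (SurfaceGroup 3)) = normalClosure (PresentedGroup.of '' s4CutSystem 0 2) :=
    stub_cutNormalForm 0 2
  conv_lhs => rw [hN2, Subgroup.map_normalClosure _ _ ψ.surjective]
  refine normalClosure_le_normal ?_
  rintro _ ⟨_, ⟨⟨j, c⟩, hx, rfl⟩, rfl⟩
  obtain rfl : c = ct j := (hct j c).1 hx
  rw [SetLike.mem_coe, MulEquiv.coe_toMonoidHom]
  refine (level_mem_iff 0 ((s4Kernels 2).map φ.toMonoidHom) (s4Kernels 2) hQnhd hQP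
    (u := φ (PresentedGroup.of (j, ct j) : SurfaceGroup 3) * (PresentedGroup.of (j, ct j) : SurfaceGroup 3)⁻¹) (x := (PresentedGroup.of (j, ct j) : SurfaceGroup 3)) (y := ψ (PresentedGroup.of (j, ct j) : SurfaceGroup 3)) ?_ (hψ _) (hφ _)).2 ?_
  · rw [inv_mul_cancel_right]
    exact ⟨_, by rw [SetLike.mem_coe, ← hπker]; exact of_cut_mem_ker hπof j, rfl⟩
  · rw [← hπker]
    refine mem_commutator_sup_of_map_mem π hπs hπnhd (mul_mem (hψ _) (inv_mem (hφ _))) ?_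
    have e : ∀ a b c : FreeGroup (Fin 3), a * b⁻¹ = (a * c⁻¹) * (b * c⁻¹)⁻¹ := fun a b c => by group
    rw [map_mul, map_inv, e _ _ (((List.finRange 3).map (fun v => ((List.finRange 3).map (fun w => if v < w then ⁅(FreeGroup.of v : FreeGroup (Fin 3)), FreeGroup.of w⁆ ^ ((if ct j then (-1 : ℤ) else 1) * D j v w) else (1 : FreeGroup (Fin 3)))).prod)).prod)]
    refine mul_mem (hD j) (inv_mem ?_)
    have hpp : ((List.finRange 3).map (fun v => ((List.finRange 3).map (fun w => if v < w then ⁅(FreeGroup.of v : FreeGroup (Fin 3)), FreeGroup.of w⁆ ^ ((if ct j then (-1 : ℤ) else 1) * D j v w) else (1 : FreeGroup (Fin 3)))).prod)).prod = ((List.finRange 3).map (fun v => ((List.finRange 3).map (fun w => if v < w then ⁅(FreeGroup.of v : FreeGroup (Fin 3)), FreeGroup.of w⁆ ^ ((if ct j then (-1 : ℤ) else 1) * D' j v w) else (1 : FreeGroup (Fin 3)))).prod)).prod :=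
      pp_congr _ _ _ _ fun v w hvw => by rw [heq j v w hvw]
    rw [hpp]
    exact hD' j

end Cut

/-! ## Assembly: the registered helper -/

/-- **Registered helper `helper_layerStepZeroReading`** (sub-goal of stub `stub_layerStepZero`, crux
stmt-SmoothPoincare4-14595).  For an IA-automorphism `α'` of `S₃` and a Goeritz–Johnson realiser `y₁`
(IA, in `Stab N₀ ∩ Stab N₁`, with `y₁(b₀)b₀⁻¹ ≡ ([b₁,b₀][b₁,b₂])⁻¹ (mod γ₃)`), the power
`y = y₁ ^ d(α')` lies in `Stab N₀ ∩ Stab N₁` and carries the level-two shadow `N₂ γ₃` onto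
`α'(N₂) γ₃`: the readings of `y` and `α'` are alternating forms with the same apex `d(α')`, hence equal,
and equal readings give equal shadows. [folklore] -/
theorem helper_layerStepZeroReading : ∀ (α' y₁ : SurfaceGroup 3 ≃* SurfaceGroup 3), (∀ s : SurfaceGroup 3, α' s * s⁻¹ ∈ (⊤ : Subgroup (SurfaceGroup 3)).lowerCentralSeries 1) → (∀ s : SurfaceGroup 3, y₁ s * s⁻¹ ∈ (⊤ : Subgroup (SurfaceGroup 3)).lowerCentralSeries 1) → (s4Kernels 0).map y₁.toMonoidHom = s4Kernels 0 → (s4Kernels 1).map y₁.toMonoidHom = s4Kernels 1 → y₁ (SurfaceGroup.b 0 : SurfaceGroup 3) * (SurfaceGroup.b 0 : SurfaceGroup 3)⁻¹ * (((SurfaceGroup.b 1 : SurfaceGroup 3) * (SurfaceGroup.b 0 : SurfaceGroup 3) * ((SurfaceGroup.b 1 : SurfaceGroup 3))⁻¹ * ((SurfaceGroup.b 0 : SurfaceGroup 3))⁻¹) * ((SurfaceGroup.b 1 : SurfaceGroup 3) * (SurfaceGroup.b 2 : SurfaceGroup 3) * ((SurfaceGroup.b 1 : SurfaceGroup 3))⁻¹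 * ((SurfaceGroup.b 2 : SurfaceGroup 3))⁻¹)) ∈ (⊤ : Subgroup (SurfaceGroup 3)).lowerCentralSeries 2 → ∃ y : SurfaceGroup 3 ≃* SurfaceGroup 3, (s4Kernels 0).map y.toMonoidHom = s4Kernels 0 ∧ (s4Kernels 1).map y.toMonoidHom = s4Kernels 1 ∧ (s4Kernels 2 ⊔ (⊤ : Subgroup (SurfaceGroup 3)).lowerCentralSeries 2).map y.toMonoidHom = (s4Kernels 2).map α'.toMonoidHom ⊔ (⊤ : Subgroup (SurfaceGroup 3)).lowerCentralSeries 2 := by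
  intro α' y₁ hα' hy₁ hy0 hy1 hJ
  -- the cut dictionary of slot `2`
  obtain ⟨ct, π, hct, hπs, hπker, hπof⟩ := helper_glueErasePi 0 2 (stub_cutNormalForm 0 2)
  have hπker' : π.ker = s4Kernels 2 := hπker
  -- readings
  obtain ⟨Dα, hα1, hα2, hDα⟩ := reading_ia hπs hπker' hπof α' hα'
  obtain ⟨D1, h11, h12, hD1⟩ := reading_ia hπs hπker' hπof y₁ hy₁
  have hapex : D1 0 1 2 = 1 := apex_eq_one hct hπof y₁ D1 hD1 hJ
  obtain ⟨hyIA, hDy⟩ := reading_zpow π y₁ hy₁ D1 hD1 (Dα 0 1 2)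
  have heq : ∀ j v w : Fin 3, v < w → (fun j v w => Dα 0 1 2 * D1 j v w) j v w = Dα j v w :=
    alt3_eq_of_apex _ _ (fun a b c => by simp only [h11 a b c, mul_neg]) (fun a b c => by simp only [h12 a b c, mul_neg])
      hα1 hα2 (by simp only [hapex, mul_one])
  have hle₁ := map_le_of_forms hct hπs hπker' hπof _ α' hyIA hα' (fun j v w => Dα 0 1 2 * D1 j v w) Dα hDy hDα heq
  have hle₂ := map_le_of_forms hct hπs hπker' hπof α' _ hα' hyIA Dα (fun j v w => Dα 0 1 2 * D1 j v w) hDα hDy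
    (fun j v w h => (heq j v w h).symm)
  refine ⟨((y₁ : MulAut (SurfaceGroup 3)) ^ (Dα 0 1 2) : MulAut (SurfaceGroup 3)), map_zpow_eq_of_map_eq y₁ hy0 _,
    map_zpow_eq_of_map_eq y₁ hy1 _, ?_⟩
  rw [Subgroup.map_sup, Summit.SmoothPoincare4.SmoothPoincare4.Theorems.NilpotentShadowsStandard.Negative.map_lcs_top_equiv]
  exact le_antisymm (sup_le hle₁ le_sup_right) (sup_le hle₂ le_sup_right)

/-! ## The registered stub -/

/-- **The layer step at `(m, c) = (0, 0)`** (registered stub `stub_layerStepZero` of the line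
`nilpotent-genus-class`; see the module docstring for the proof). [folklore] -/
theorem stub_layerStepZero :
    (∀ (g : ℕ) (φ : SurfaceGroup g ≃* SurfaceGroup g),
      ∃ (F : (surfaceGen g → ℤ) ≃ₗ[ℤ] (surfaceGen g → ℤ)) (ε : ℤ), (ε = 1 ∨ ε = -1) ∧
        (∀ s : SurfaceGroup g,
          toAdd (SurfaceGroup.abelianize g (φ s)) = F (toAdd (SurfaceGroup.abelianize g s))) ∧
        ∀ u v : surfaceGen g → ℤ, symplForm (F u) (F v) = ε * symplForm u v) →
    (∀ (F : (surfaceGen (3 + 3 * 0) → ℤ) ≃ₗ[ℤ] (surfaceGen (3 + 3 * 0) → ℤ)) (ε : ℤ), (ε = 1 ∨ ε = -1) →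
      (∀ u v : surfaceGen (3 + 3 * 0) → ℤ, symplForm (F u) (F v) = ε * symplForm u v) →
      (Submodule.span ℤ ((fun y => (Pi.single y (1 : ℤ) : surfaceGen (3 + 3 * 0) → ℤ)) ''
          s4CutSystem 0 0)).map F.toLinearMap =
        Submodule.span ℤ ((fun y => (Pi.single y (1 : ℤ) : surfaceGen (3 + 3 * 0) → ℤ)) ''
          s4CutSystem 0 0) →
      (Submodule.span ℤ ((fun y => (Pi.single y (1 : ℤ) : surfaceGen (3 + 3 * 0) → ℤ)) ''
          s4CutSystem 0 1)).map F.toLinearMap =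
        Submodule.span ℤ ((fun y => (Pi.single y (1 : ℤ) : surfaceGen (3 + 3 * 0) → ℤ)) ''
          s4CutSystem 0 1) →
      ∃ x : SurfaceGroup (3 + 3 * 0) ≃* SurfaceGroup (3 + 3 * 0),
        (s4Kernels.stabilizeIter 0 0).map x.toMonoidHom = s4Kernels.stabilizeIter 0 0 ∧
        (s4Kernels.stabilizeIter 0 1).map x.toMonoidHom = s4Kernels.stabilizeIter 0 1 ∧
        ∀ s : SurfaceGroup (3 + 3 * 0),
          toAdd (SurfaceGroup.abelianize (3 + 3 * 0) (x s)) =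
            F (toAdd (SurfaceGroup.abelianize (3 + 3 * 0) s))) →
    ∀ (K : TrisectionKernels (3 + 3 * 0)),
      IsGroupTrisection (3 + 3 * 0) (0 + 1) (PUnit : Type) K →
      K 0 = s4Kernels.stabilizeIter 0 0 → K 1 = s4Kernels.stabilizeIter 0 1 →
      (∀ i j : Fin 3, i ≠ j → ∃ α : SurfaceGroup (3 + 3 * 0) ≃* SurfaceGroup (3 + 3 * 0),
        (s4Kernels.stabilizeIter 0 i).map α.toMonoidHom = K i ∧
          (s4Kernels.stabilizeIter 0 j).map α.toMonoidHom = K j) →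
      (∀ M : Subgroup (SurfaceGroup (3 + 3 * 0)), M.Characteristic → M.FiniteIndex →
        ∃ ψ : SurfaceGroup (3 + 3 * 0) ≃* SurfaceGroup (3 + 3 * 0), ∀ i : Fin 3,
          (s4Kernels.stabilizeIter 0 i ⊔ M).map ψ.toMonoidHom = K i ⊔ M) →
      K 2 ⊔ (⊤ : Subgroup (SurfaceGroup (3 + 3 * 0))).lowerCentralSeries (0 + 1) =
        s4Kernels.stabilizeIter 0 2 ⊔ (⊤ : Subgroup (SurfaceGroup (3 + 3 * 0))).lowerCentralSeries (0 + 1) →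
      ∃ y : SurfaceGroup (3 + 3 * 0) ≃* SurfaceGroup (3 + 3 * 0),
        (s4Kernels.stabilizeIter 0 0).map y.toMonoidHom = s4Kernels.stabilizeIter 0 0 ∧
        (s4Kernels.stabilizeIter 0 1).map y.toMonoidHom = s4Kernels.stabilizeIter 0 1 ∧
        (s4Kernels.stabilizeIter 0 2 ⊔ (⊤ : Subgroup (SurfaceGroup (3 + 3 * 0))).lowerCentralSeries (0 + 1 + 1)).map
            y.toMonoidHom =
          K 2 ⊔ (⊤ : Subgroup (SurfaceGroup (3 + 3 * 0))).lowerCentralSeries (0 + 1 + 1) := by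
  intro hA hR K _hK hK0 _hK1 hW _hS hK2
  -- the pair `(0, 2)`: `α ∈ Stab N₀` with `α(N₂) = K₂`
  obtain ⟨α, hα0, hα2⟩ := hW 0 2 (by decide)
  have hα0' : (s4Kernels 0).map α.toMonoidHom = s4Kernels 0 := by
    have h : (s4Kernels.stabilizeIter 0 0).map α.toMonoidHom = K 0 := hα0
    rw [hK0] at h
    exact h
  have hα2' : (s4Kernels 2).map α.toMonoidHom = K 2 := hα2
  have hK2' : K 2 ⊔ (⊤ : Subgroup (SurfaceGroup 3)).lowerCentralSeries 1 =
      s4Kernels 2 ⊔ (⊤ : Subgroup (SurfaceGroup 3)).lowerCentralSeries 1 := hK2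
  -- (1) pair normalisation: an IA-automorphism `α'` with `α'(N₂) = K₂`
  obtain ⟨α', hα', hα'2⟩ := exists_ia_of_pair (hA 3) hR hα0' hα2' hK2'
  -- (2) the Goeritz–Johnson realiser `y₁ ∈ A ∩ B`
  obtain ⟨y₁, hy0, hy1, hy₁, hJ⟩ := exists_goeritzJohnson hR
  -- (3) reading: `y = y₁ ^ d(α')`
  obtain ⟨y, h0, h1, h2⟩ := helper_layerStepZeroReading α' y₁ hα' hy₁ hy0 hy1 hJ
  refine ⟨y, h0, h1, ?_⟩
  show (s4Kernels 2 ⊔ (⊤ : Subgroup (SurfaceGroup 3)).lowerCentralSeries 2).map y.toMonoidHom =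
    K 2 ⊔ (⊤ : Subgroup (SurfaceGroup 3)).lowerCentralSeries 2
  rw [h2, hα'2]

end Summit.SmoothPoincare4.SmoothPoincare4.Theorems.ShadowApproximation.NilpotentGenusClass

end
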